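import Summits.QuantumFields.YangMills.Theorems.BalabanUVNodesN20WildMassLetterOfPersistentHistoryCount
import Summits.QuantumFields.YangMills.Theorems.BalabanUVNodesN19TameTiltLetterOfKPMargin

/-!
# BalabanUVNodes ∕ node N20 (NE7b) — THE (H) LETTER OF THE HELLINGER ROAD WITH BOTH INPUT BLOCKS DISCHARGED TO ONE-RUN STRUCTURAL LETTERS:
# (V‑a) ⟸ two single-slot dominations of the keyed polymer gas (log two-rate budget, exponent 2), (KR)+(V‑b) ⟸ two one-run KP margins on the tame sub-gas

Cell `pub-ymgap` (HUMAN RULING D-0062 Track A ∕ director-ym R399 (3a) second-wave width seats), WIDTH SEAT `pub-ymgap-dag-n20-w4` (node n20 = NE7b),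
generation g3, CLAIM-2 ∕ INTENT-2 (bus I.35312 ∕ S.21702, 2026-08-28T09:34Z; FILE 2 of this generation — FILE 1 = p621499
`…N20WildMassLetterOfPersistentHistoryCount`).  Route `Summits/QuantumFields/YangMills/Theses/BalabanUVNodes.lean`, key item K3⁷ `SpineGivenEndpointR13SepCoPH`
(stmt-QuantumFields-20544; skeleton of record v5 941dddb108cbaacf, stub 2 `stub_expansion13H`, faces N20 `KeyedRelWeight` ∕ N19′ core edge); filed
`--kind proof --supports … --as helper`.  COUNT-NEUTRAL.  THEOREMS ONLY (0 `def`, 0 `instance`, 0 `notation`, 0 `sorry`).  ADDITIVE — imports FILE 1 (p621499;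
through it `T4MatchingClosure` ∕ `T4PersistentHistoryCount` ∕ `T4HistoryPeeling` ∕ `T4GoodClassBudget` and dag-n19-w4's p618979) and dag-n19-w4 g6's p620730
`…N19TameTiltLetterOfKPMargin` BY NAME; modifies nothing, re-declares nothing.

WHAT.  Idea-3's hellinger road (card `Cruxes/SpineGivenEndpointR13SepCoPH/Ideas/hellinger-free-energy-road.md`, editions 4–6; kernel ed.4 §13) sums the per-key
affinity defect `1 − 𝒜_K(t) = 1 − Σ_T √(p_A p_B)` of the two runs' ONE-RUN class laws along `K`; its K-summation of record — on the tree as dag-n19-w4's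
`…N19TameConditionedHellingerLetterAlongK.affinityDefectLetter_of_tameTilts` (p618979) — has TWO input blocks: the WILD-MASS block `(wm, hwm, hwildA, hwildB, hws)`
(letter (V‑a): each run's own over-aged mass `≤ wm K`, `Σ_K √wm_K < ∞`) and the TAME-TILT block (letters (KR)+(V‑b): analytic tilts of the tame-restricted class
sums with one bound `𝔅`, radii `Σ 1∕r_K < ∞`, the tame regime).  Both blocks now have ONE-RUN STRUCTURAL suppliers in the tree:
* (V‑a): FILE 1's `wildMassLetter_of_slotDom_twoRate_log` — two `T4HistoryPeeling.SlotDom`s (single-slot context-uniform insertion prices, one per run) at the log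
  two-rate budget `Cs·V·ϱ^{K − jlog_C(K)+1}∕(1 − ϱ)` with `2 < C·(−log ϱ)` ⇒ the block (via the cell `pub-balaban`'s `relWeightBound_of_slotDom_twoRate_log` and
  `T4GoodClassBudget.summable_weightMajorant_log` at `√ϱ`); one level lower FILE 1's `wildMassLetter_of_records_log` (per-record prices,
  `T4PersistentHistoryCount.slotDom_of_records`).
* (KR)+(V‑b): dag-n19-w4 g6's `…N19TameTiltLetterOfKPMargin.affinityDefectLetter_of_kpMargins` (p620730) — on the KEYED POLYMER GAS (classes = compatible families
  `X ⊆ Λ K`, multiplicative weights `∏_{γ∈X} a K t γ`, wild classes = families MEETING the over-aged set `O K t`), two weighted one-run KP margins on the tame sub-gas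
  `Λ K ∖ O K t` at radius `r K` (the two-run increment `|log b − log a|` absorbed in the margin — (V‑b) spent on the radius), ONE bound `𝔄`, the tame regime ⇒ the
  (H) letter, KEEPING the wild-mass block as hypotheses.
THIS FILE composes the two BY NAME:
* §1 ★★★ `affinityDefectLetter_of_slotDoms_and_kpMargins` — p620730's `affinityDefectLetter_of_kpMargins` with its wild-mass block DISCHARGED by two `SlotDom`s on the
  keyed-gas carrier (`T K :=` compatible families of `Λ K`, `A K t X := ∏_{γ∈X} a K t γ`, `Bad K t :=` the families meeting `O K t`) at the log two-rate budget with
  `2 < C·(−log ϱ)`: ⟹ `∃ η ≥ 0`, `Σ_K √η_K < ∞`, `1 − 𝒜_K(t) ≤ η_K` for all `K`, `|t| ≤ l₀`; ★ `hellingerRate_of_slotDoms_and_kpMargins` — the ρ-shape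
  (`∃ ρ` summable, `√(1 − 𝒜_K(t)) ≤ ρ_K`), the input of the per-set-TV ∕ class-law roads (dag-n19-w2 p612301, this seat's g0 p609004 `exists_hybridNE7_of_target_of_classLawTV`,
  dag-n20-w5's endpoint road).
* §2 ★★ `affinityDefectLetter_of_records_and_kpMargins` — ONE LEVEL LOWER on the (V‑a) side: `T4PersistentHistoryCount.slotDom_of_records`' per-record PRICES for both
  runs (birth cells `#Cell K a ≤ V·Λ₀^a`, event windows, birth∕event residuals, switch-off data whose bad class IS the set of wild families, slots born below the log cut
  `jlog_C(K)`), `2 < C·(−log(Λ₀·e^{η̄ − κ₁}))`, + the same KP-margin letters ⇒ the (H) letter.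
* §3 `slotDom_of_bad_eq_empty` (A6 bookkeeping: the `SlotDom` hypothesis is inhabited — trivially — whenever the wild class is empty; with p620730's `toy_noPolymers` the
  whole antecedent of §1 is jointly satisfiable on the empty gas).  The exponent-2 rate in the memo's words is FILE 1's `two_lt_mul_neg_log_twoRate_iff`
  (`2 < C·(−log(L⁴·e^{η̄−κ₁})) ↔ 2 < C·(κ₁ − η̄ − 4·log L)`), not re-exported.
DICTIONARY (memo `OVERAGE-RATE-READING-idea3-g13.md` ↔ tree, as in FILE 1's header): `ϱ = Λ₀σ`, `Λ₀ = L⁴` positions per step of age, `σ = e^{η̄ − κ₁}` the per-step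
survival of `T4PersistentHistoryCount.slotPrice_le`; `C` = the log-window constant (memo's `κ₁`); `−log ϱ = κ₁ − η̄ − 4 log L` = memo's `c − 4 log L`.
CREDIT.  The road and its K-summation: idea-3 g10–g14; R2 and the re-prices: CRIT-1 g5∕g6; the tame-tilt∕KP-margin side and the keyed-gas carrier: dag-n19-w4 g5∕g6
(p614272, p618660, p618979, p620730); the persistent-history kernel: cell `pub-balaban` (`T4WeightBudget`, `T4HistoryPeeling`, `T4PersistentHistoryCount`, `T4GoodClassBudget`,
`T4MatchingClosure`); the abstract-refresh-process twin of the (V‑a) supplier: dag-n20-w5 g4 (`…N20OverAgeRefreshProcess`, p621610) — a consumer may use either.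

HONEST FRAMING.  [folklore] by-name composition on hypothesis SHAPES.  EVERY letter — the two `SlotDom`s ∕ the per-record prices (the single-slot CONTEXT-UNIFORM
insertion price = the cards' (KR) + «printed factors as upper bounds on relative keyed class weights», the unprinted heart of NE7b), the multiplicative keyed structure,
the KP margins with the two-run increment in the exponent ((V‑b) = (YG), two-run, UNPRINTED for d = 4), `𝔄`, the radii `Σ 1∕r_K < ∞`, the tame regime, the rate
condition `2 < C·(−log ϱ)` — is a HYPOTHESIS produced by nobody; (V‑a)'s truth for Bałaban's densities is idea-3 g13's paper READING of [Balaban1989LargeFieldII]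
(1.79)–(1.85), not asserted here; NO estimate of Bałaban's programme is proved; nothing of Bałaban's asserted or instantiated (no `Provisos₁₃SepCoPH` tuple — K0⁷ OPEN;
(KR) is typable against the datum only once plan v6 exposes the keyed carriers at `wkey`); NE7 ∕ NE7b ∕ NE7c NOT PRINTED as two-run statements for d = 4 and NOT
proved; N19 ∕ N20 ∕ N21 NOT discharged; K3⁷ OPEN, v5 STANDS, not claimed; counts UNMOVED (typed 28∕28 · discharged 5∕27, A 5∕28); no summit statement is proved by
this seat.  One finite four-torus programme at fixed ε — NOT ℝ⁴, NOT infinite volume, NOT OS, NOT a mass gap, NOT the Clay problem (R4 closes the conditional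
finite-𝕋⁴ rung `BalabanLadder.UV` only).  0 `def`; 0 `sorry`; standard axioms; no cite tags.
-/

noncomputable section

namespace Summit.QuantumFields.YangMills.BalabanUVNodes.N20HellingerLetterOfSlotPricesAndKPMargins

open Finset
open Literature.Probability.LatticeModels (IsCompatible)
open Literature.MathematicalPhysics.QuantumFieldTheory.Balaban1983to89.T4HistoryPeeling (SwitchOff SlotDom)
open Literature.MathematicalPhysics.QuantumFieldTheory.Balaban1983to89.T4GoodClassBudget (jlogOf)
open Literature.MathematicalPhysics.QuantumFieldTheory.Balaban1983to89.T4PersistentHistoryCount (records)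
open Summit.QuantumFields.YangMills.BalabanUVNodes.N19TameConditionedHellingerLetterAlongK (exists_summable_sqrt_rate)
open Summit.QuantumFields.YangMills.BalabanUVNodes.N19TameTiltLetterOfKPMargin (affinityDefectLetter_of_kpMargins)
open Summit.QuantumFields.YangMills.BalabanUVNodes.N20WildMassLetterOfPersistentHistoryCount
  (wildMassLetter_of_slotDom_twoRate_log wildMassLetter_of_records_log)

variable {P : Type*} [DecidableEq P] (inc : P → P → Prop) [DecidableRel inc]

/-! ## §1 (V‑a) from two `SlotDom`s on the keyed gas + (KR)+(V‑b) from two KP margins ⇒ the (H) letter [folklore, by name] -/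

section SlotPrices

/-- **★★★ THE (H) LETTER FROM SINGLE-SLOT PRICES AND KP MARGINS** — dag-n19-w4's `affinityDefectLetter_of_kpMargins` (p620730) with its wild-mass block
`(wm, hwm, hwildA, hwildB, hws)` DISCHARGED by FILE 1's `wildMassLetter_of_slotDom_twoRate_log` on the keyed-gas carrier.  Data per key `K` and source `|t| ≤ l₀`:
polymers `Λ K`, over-aged polymers `O K t`, POSITIVE one-run activities `a K t`, `b K t` (class weights `∏_{γ∈X} a`, `∏_{γ∈X} b` on the compatible families
`X ⊆ Λ K`; wild classes = families meeting `O K t`).  (V‑a) SIDE: `SlotDom` for run A and for run B on that carrier with the wild families as bad class and the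
log two-rate budget `Cs·V·ϱ^{K − jlog_C(K)+1}∕(1 − ϱ)`, `0 < ϱ < 1`, `Cs, V ≥ 0`, EXPONENT-2 rate `2 < C·(−log ϱ)`.  (KR)+(V‑b) SIDE (p620730 §6 verbatim): KP-size
functions `aszA, aszB` with `Σ_{Λ K ∖ O K t} asz ≤ 𝔄`, weighted one-run KP margins on `Λ K ∖ O K t` at radius `r K` with the increment `|log b − log a|` in the
exponent, `Σ 1∕r K < ∞`, the tame regime `1 − 𝒜_tame ≤ 1∕16` from `K₀` on.  CONCLUSION: `∃ η ≥ 0` with `Σ_K √η_K < ∞` and `1 − 𝒜_K(t) ≤ η_K` for all `K`,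
`|t| ≤ l₀`.  HONEST: every letter is a HYPOTHESIS produced by nobody; (V‑b) = (YG) two-run, UNPRINTED for d = 4. [folklore] -/
theorem affinityDefectLetter_of_slotDoms_and_kpMargins [Std.Refl inc] [Std.Symm inc] {l₀ : ℝ}
    (Λ : ℕ → Finset P) (O : ℕ → ℝ → Finset P) (a b aszA aszB : ℕ → ℝ → P → ℝ)
    (ha : ∀ K t, |t| ≤ l₀ → ∀ γ ∈ Λ K, 0 < a K t γ) (hb : ∀ K t, |t| ≤ l₀ → ∀ γ ∈ Λ K, 0 < b K t γ)
    {Cs V ϱ C : ℝ} (hCs : 0 ≤ Cs) (hV : 0 ≤ V) (h0 : 0 < ϱ) (h1 : ϱ < 1) (hC : 2 < C * (-Real.log ϱ))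
    (hDA : SlotDom l₀ (fun K => (Λ K).powerset.filter (fun X => IsCompatible inc X)) (fun K t X => ∏ γ ∈ X, a K t γ)
      (fun K t => ((Λ K).powerset.filter (fun X => IsCompatible inc X)).filter (fun X => ¬ Disjoint X (O K t)))
      (fun K => Cs * V * (ϱ ^ (K - jlogOf C K + 1) / (1 - ϱ))))
    (hDB : SlotDom l₀ (fun K => (Λ K).powerset.filter (fun X => IsCompatible inc X)) (fun K t X => ∏ γ ∈ X, b K t γ)
      (fun K t => ((Λ K).powerset.filter (fun X => IsCompatible inc X)).filter (fun X => ¬ Disjoint X (O K t)))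
      (fun K => Cs * V * (ϱ ^ (K - jlogOf C K + 1) / (1 - ϱ))))
    (r : ℕ → ℝ) (hr : ∀ K, 0 < r K) (hrs : Summable fun K => 1 / r K)
    {𝔄 : ℝ} (h𝔄 : 0 ≤ 𝔄)
    (h𝔄A : ∀ K t, |t| ≤ l₀ → ∑ γ ∈ Λ K \ O K t, aszA K t γ ≤ 𝔄) (h𝔄B : ∀ K t, |t| ≤ l₀ → ∑ γ ∈ Λ K \ O K t, aszB K t γ ≤ 𝔄)
    (hKPa : ∀ K t, |t| ≤ l₀ → ∀ γ ∈ Λ K \ O K t, ∑ γ' ∈ (Λ K \ O K t) with inc γ' γ,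
      a K t γ' * Real.exp (r K * |Real.log (b K t γ') - Real.log (a K t γ')|) * Real.exp (aszA K t γ') ≤ aszA K t γ)
    (hKPb : ∀ K t, |t| ≤ l₀ → ∀ γ ∈ Λ K \ O K t, ∑ γ' ∈ (Λ K \ O K t) with inc γ' γ,
      b K t γ' * Real.exp (r K * |Real.log (b K t γ') - Real.log (a K t γ')|) * Real.exp (aszB K t γ') ≤ aszB K t γ)
    (K₀ : ℕ) (hreg : ∀ K, K₀ ≤ K → ∀ t, |t| ≤ l₀ →
      1 - ∑ X ∈ (Λ K \ O K t).powerset with IsCompatible inc X,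
        Real.sqrt (((∏ γ ∈ X, a K t γ) / ∑ Y ∈ (Λ K \ O K t).powerset with IsCompatible inc Y, ∏ γ ∈ Y, a K t γ)
          * ((∏ γ ∈ X, b K t γ) / ∑ Y ∈ (Λ K \ O K t).powerset with IsCompatible inc Y, ∏ γ ∈ Y, b K t γ)) ≤ 1 / 16) :
    ∃ η : ℕ → ℝ, (∀ K, 0 ≤ η K) ∧ Summable (fun K => Real.sqrt (η K)) ∧
      ∀ K t, |t| ≤ l₀ →
        1 - ∑ X ∈ (Λ K).powerset with IsCompatible inc X,
          Real.sqrt (((∏ γ ∈ X, a K t γ) / ∑ Y ∈ (Λ K).powerset with IsCompatible inc Y, ∏ γ ∈ Y, a K t γ)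
            * ((∏ γ ∈ X, b K t γ) / ∑ Y ∈ (Λ K).powerset with IsCompatible inc Y, ∏ γ ∈ Y, b K t γ)) ≤ η K := by
  -- class weights are non-negative on the compatible families (products of positive activities)
  have hXΛ : ∀ K, ∀ X ∈ (Λ K).powerset.filter (fun X => IsCompatible inc X), X ⊆ Λ K :=
    fun K X hX => Finset.mem_powerset.1 (Finset.mem_filter.1 hX).1
  have hA : ∀ K t, |t| ≤ l₀ → ∀ X ∈ (Λ K).powerset.filter (fun X => IsCompatible inc X), 0 ≤ ∏ γ ∈ X, a K t γ :=
    fun K t ht X hX => Finset.prod_nonneg fun γ hγ => (ha K t ht γ (hXΛ K X hX hγ)).le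
  have hB : ∀ K t, |t| ≤ l₀ → ∀ X ∈ (Λ K).powerset.filter (fun X => IsCompatible inc X), 0 ≤ ∏ γ ∈ X, b K t γ :=
    fun K t ht X hX => Finset.prod_nonneg fun γ hγ => (hb K t ht γ (hXΛ K X hX hγ)).le
  -- the (V‑a) block from the two single-slot dominations (FILE 1, exponent 2)
  obtain ⟨wm, hwm, hwA, hwB, hws⟩ := wildMassLetter_of_slotDom_twoRate_log hCs hV h0 h1 hC hA hB hDA hDB
  -- the (H) letter from p620730 with that block supplied
  exact affinityDefectLetter_of_kpMargins inc Λ O a b aszA aszB ha hb wm hwm hwA hwB hws r hr hrs h𝔄 h𝔄A h𝔄B hKPa hKPb K₀ hreg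

/-- **★ THE SUMMABLE HELLINGER RATE FROM SINGLE-SLOT PRICES AND KP MARGINS** — the ρ-shape of §1's letter: `∃ ρ ≥ 0` summable with
`√(1 − 𝒜_K(t)) ≤ ρ_K` for all `K`, `|t| ≤ l₀` (dag-n19-w4's `exists_summable_sqrt_rate` by name) — the input of the per-set-TV ∕ class-law roads. [folklore] -/
theorem hellingerRate_of_slotDoms_and_kpMargins [Std.Refl inc] [Std.Symm inc] {l₀ : ℝ}
    (Λ : ℕ → Finset P) (O : ℕ → ℝ → Finset P) (a b aszA aszB : ℕ → ℝ → P → ℝ)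
    (ha : ∀ K t, |t| ≤ l₀ → ∀ γ ∈ Λ K, 0 < a K t γ) (hb : ∀ K t, |t| ≤ l₀ → ∀ γ ∈ Λ K, 0 < b K t γ)
    {Cs V ϱ C : ℝ} (hCs : 0 ≤ Cs) (hV : 0 ≤ V) (h0 : 0 < ϱ) (h1 : ϱ < 1) (hC : 2 < C * (-Real.log ϱ))
    (hDA : SlotDom l₀ (fun K => (Λ K).powerset.filter (fun X => IsCompatible inc X)) (fun K t X => ∏ γ ∈ X, a K t γ)
      (fun K t => ((Λ K).powerset.filter (fun X => IsCompatible inc X)).filter (fun X => ¬ Disjoint X (O K t)))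
      (fun K => Cs * V * (ϱ ^ (K - jlogOf C K + 1) / (1 - ϱ))))
    (hDB : SlotDom l₀ (fun K => (Λ K).powerset.filter (fun X => IsCompatible inc X)) (fun K t X => ∏ γ ∈ X, b K t γ)
      (fun K t => ((Λ K).powerset.filter (fun X => IsCompatible inc X)).filter (fun X => ¬ Disjoint X (O K t)))
      (fun K => Cs * V * (ϱ ^ (K - jlogOf C K + 1) / (1 - ϱ))))
    (r : ℕ → ℝ) (hr : ∀ K, 0 < r K) (hrs : Summable fun K => 1 / r K)
    {𝔄 : ℝ} (h𝔄 : 0 ≤ 𝔄)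
    (h𝔄A : ∀ K t, |t| ≤ l₀ → ∑ γ ∈ Λ K \ O K t, aszA K t γ ≤ 𝔄) (h𝔄B : ∀ K t, |t| ≤ l₀ → ∑ γ ∈ Λ K \ O K t, aszB K t γ ≤ 𝔄)
    (hKPa : ∀ K t, |t| ≤ l₀ → ∀ γ ∈ Λ K \ O K t, ∑ γ' ∈ (Λ K \ O K t) with inc γ' γ,
      a K t γ' * Real.exp (r K * |Real.log (b K t γ') - Real.log (a K t γ')|) * Real.exp (aszA K t γ') ≤ aszA K t γ)
    (hKPb : ∀ K t, |t| ≤ l₀ → ∀ γ ∈ Λ K \ O K t, ∑ γ' ∈ (Λ K \ O K t) with inc γ' γ,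
      b K t γ' * Real.exp (r K * |Real.log (b K t γ') - Real.log (a K t γ')|) * Real.exp (aszB K t γ') ≤ aszB K t γ)
    (K₀ : ℕ) (hreg : ∀ K, K₀ ≤ K → ∀ t, |t| ≤ l₀ →
      1 - ∑ X ∈ (Λ K \ O K t).powerset with IsCompatible inc X,
        Real.sqrt (((∏ γ ∈ X, a K t γ) / ∑ Y ∈ (Λ K \ O K t).powerset with IsCompatible inc Y, ∏ γ ∈ Y, a K t γ)
          * ((∏ γ ∈ X, b K t γ) / ∑ Y ∈ (Λ K \ O K t).powerset with IsCompatible inc Y, ∏ γ ∈ Y, b K t γ)) ≤ 1 / 16) :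
    ∃ ρ : ℕ → ℝ, Summable ρ ∧ (∀ K, 0 ≤ ρ K) ∧ ∀ K t, |t| ≤ l₀ →
      Real.sqrt (1 - ∑ X ∈ (Λ K).powerset with IsCompatible inc X,
          Real.sqrt (((∏ γ ∈ X, a K t γ) / ∑ Y ∈ (Λ K).powerset with IsCompatible inc Y, ∏ γ ∈ Y, a K t γ)
            * ((∏ γ ∈ X, b K t γ) / ∑ Y ∈ (Λ K).powerset with IsCompatible inc Y, ∏ γ ∈ Y, b K t γ))) ≤ ρ K := by
  obtain ⟨η, _, hηs, hη⟩ := affinityDefectLetter_of_slotDoms_and_kpMargins inc Λ O a b aszA aszB ha hb hCs hV h0 h1 hC hDA hDB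
    r hr hrs h𝔄 h𝔄A h𝔄B hKPa hKPb K₀ hreg
  exact exists_summable_sqrt_rate (x := fun K t => 1 - ∑ X ∈ (Λ K).powerset with IsCompatible inc X,
          Real.sqrt (((∏ γ ∈ X, a K t γ) / ∑ Y ∈ (Λ K).powerset with IsCompatible inc Y, ∏ γ ∈ Y, a K t γ)
            * ((∏ γ ∈ X, b K t γ) / ∑ Y ∈ (Λ K).powerset with IsCompatible inc Y, ∏ γ ∈ Y, b K t γ))) hηs hη

end SlotPrices

/-! ## §2 One level lower on the (V‑a) side: per-record PRICES for both runs + KP margins ⇒ the (H) letter [folklore, by name] -/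

section RecordPrices

variable {γc ε : Type*} [DecidableEq γc] [DecidableEq ε]

/-- **★★ THE (H) LETTER FROM PER-RECORD PRICES AND KP MARGINS** — §1 with the two `SlotDom`s replaced by their construction from
`T4PersistentHistoryCount.slotDom_of_records` (FILE 1's `wildMassLetter_of_records_log`): for EACH run, per `(K,t)` a switch-off structure on the compatible
families of `Λ K` whose bad class IS the set of families meeting `O K t`, slots injectively labelled by (birth step `< jlog_C(K)`, birth cell ∈ `Cell K (K − birth)`,
`#Cell K a ≤ V·Λ₀^a`), per-record prices `y ≤ ρ b·e^{−κ₁ W b}·Π_{e∈Q}(e^{−κ₁ W e}·η e)` over the records of the event universe `E K j` (events at steps in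
`(j, K]`, windows `W`, birth residuals `Σ_b ρ b ≤ ρ̄`, event residuals `≤ η̄` per step) and the single-slot ratio bound with ratio `Σ_b Σ_Q y`; rate
`0 < Λ₀·e^{η̄−κ₁} < 1` with EXPONENT 2 `2 < C·(−log(Λ₀·e^{η̄−κ₁}))`; plus §1's KP-margin letters ⇒ `∃ η ≥ 0`, `Σ√η_K < ∞`, `1 − 𝒜_K(t) ≤ η_K`.
HONEST: the per-record price (uniform in the context) is the unprinted single-slot insertion estimate — a HYPOTHESIS produced by nobody. [folklore] -/
theorem affinityDefectLetter_of_records_and_kpMargins [Std.Refl inc] [Std.Symm inc] {l₀ : ℝ}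
    (Λ : ℕ → Finset P) (O : ℕ → ℝ → Finset P) (a b aszA aszB : ℕ → ℝ → P → ℝ)
    (ha : ∀ K t, |t| ≤ l₀ → ∀ γ ∈ Λ K, 0 < a K t γ) (hb : ∀ K t, |t| ≤ l₀ → ∀ γ ∈ Λ K, 0 < b K t γ)
    (Cell : ℕ → ℕ → Finset γc) {V Λ₀ : ℝ} (hV : 0 ≤ V) (hΛ₀ : 0 ≤ Λ₀)
    (hcell : ∀ K n, ((Cell K n).card : ℝ) ≤ V * Λ₀ ^ n) (Wd : ε → ℕ) (step : ε → ℕ)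
    (E Bi : ℕ → ℕ → Finset ε) (hE : ∀ K j, ∀ e ∈ E K j, step e ∈ Ioc j K) {κ₁ ρbar ηbar C : ℝ} (hκ : 0 ≤ κ₁)
    (ρ : ε → ℝ) (hρ : ∀ K j, ∀ b' ∈ Bi K j, 0 ≤ ρ b') (hρbar : ∀ K j, ∑ b' ∈ Bi K j, ρ b' ≤ ρbar) (hρbar0 : 0 ≤ ρbar)
    (η : ε → ℝ) (hη : ∀ K j, ∀ e ∈ E K j, 0 ≤ η e)
    (hηbar : ∀ K j, ∀ s ∈ Ioc j K, ∑ e ∈ E K j with step e = s, η e ≤ ηbar)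
    (hr0 : 0 < Λ₀ * Real.exp (ηbar - κ₁)) (hr1 : Λ₀ * Real.exp (ηbar - κ₁) < 1)
    (hC : 2 < C * (-Real.log (Λ₀ * Real.exp (ηbar - κ₁))))
    (hdomA : ∀ K t, |t| ≤ l₀ → ∃ (n : ℕ) (Φ : SwitchOff ((Λ K).powerset.filter (fun X => IsCompatible inc X)) n)
        (birth : Fin n → ℕ) (cell : Fin n → γc) (y : Fin n → ε → Finset ε → ℝ),
      ((Λ K).powerset.filter (fun X => IsCompatible inc X)).filter (fun X => ¬ Disjoint X (O K t)) = Φ.bad ∧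
      (∀ i, birth i < jlogOf C K) ∧ (∀ i, cell i ∈ Cell K (K - birth i)) ∧
      Function.Injective (fun i => (⟨birth i, cell i⟩ : Σ _ : ℕ, γc)) ∧
      (∀ i, ∀ b' ∈ Bi K (birth i), ∀ Q ∈ records Wd (birth i) K (E K (birth i)) b', 0 ≤ y i b' Q) ∧
      (∀ i, ∀ b' ∈ Bi K (birth i), ∀ Q ∈ records Wd (birth i) K (E K (birth i)) b',
        y i b' Q ≤ ρ b' * Real.exp (-(κ₁ * Wd b')) * ∏ e ∈ Q, (Real.exp (-(κ₁ * Wd e)) * η e)) ∧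
      ∀ i : Fin n, ∀ τ'' ∈ (Λ K).powerset.filter (fun X => IsCompatible inc X), Φ.pend i τ'' = false →
        ∑ τ ∈ ((Λ K).powerset.filter (fun X => IsCompatible inc X)) with (Φ.pend i τ = true ∧ Φ.off i τ = τ''), ∏ γ ∈ τ, a K t γ
          ≤ (∑ b' ∈ Bi K (birth i), ∑ Q ∈ records Wd (birth i) K (E K (birth i)) b', y i b' Q) * ∏ γ ∈ τ'', a K t γ)
    (hdomB : ∀ K t, |t| ≤ l₀ → ∃ (n : ℕ) (Φ : SwitchOff ((Λ K).powerset.filter (fun X => IsCompatible inc X)) n)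
        (birth : Fin n → ℕ) (cell : Fin n → γc) (y : Fin n → ε → Finset ε → ℝ),
      ((Λ K).powerset.filter (fun X => IsCompatible inc X)).filter (fun X => ¬ Disjoint X (O K t)) = Φ.bad ∧
      (∀ i, birth i < jlogOf C K) ∧ (∀ i, cell i ∈ Cell K (K - birth i)) ∧
      Function.Injective (fun i => (⟨birth i, cell i⟩ : Σ _ : ℕ, γc)) ∧
      (∀ i, ∀ b' ∈ Bi K (birth i), ∀ Q ∈ records Wd (birth i) K (E K (birth i)) b', 0 ≤ y i b' Q) ∧
      (∀ i, ∀ b' ∈ Bi K (birth i), ∀ Q ∈ records Wd (birth i) K (E K (birth i)) b',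
        y i b' Q ≤ ρ b' * Real.exp (-(κ₁ * Wd b')) * ∏ e ∈ Q, (Real.exp (-(κ₁ * Wd e)) * η e)) ∧
      ∀ i : Fin n, ∀ τ'' ∈ (Λ K).powerset.filter (fun X => IsCompatible inc X), Φ.pend i τ'' = false →
        ∑ τ ∈ ((Λ K).powerset.filter (fun X => IsCompatible inc X)) with (Φ.pend i τ = true ∧ Φ.off i τ = τ''), ∏ γ ∈ τ, b K t γ
          ≤ (∑ b' ∈ Bi K (birth i), ∑ Q ∈ records Wd (birth i) K (E K (birth i)) b', y i b' Q) * ∏ γ ∈ τ'', b K t γ)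
    (r : ℕ → ℝ) (hr : ∀ K, 0 < r K) (hrs : Summable fun K => 1 / r K)
    {𝔄 : ℝ} (h𝔄 : 0 ≤ 𝔄)
    (h𝔄A : ∀ K t, |t| ≤ l₀ → ∑ γ ∈ Λ K \ O K t, aszA K t γ ≤ 𝔄) (h𝔄B : ∀ K t, |t| ≤ l₀ → ∑ γ ∈ Λ K \ O K t, aszB K t γ ≤ 𝔄)
    (hKPa : ∀ K t, |t| ≤ l₀ → ∀ γ ∈ Λ K \ O K t, ∑ γ' ∈ (Λ K \ O K t) with inc γ' γ,
      a K t γ' * Real.exp (r K * |Real.log (b K t γ') - Real.log (a K t γ')|) * Real.exp (aszA K t γ') ≤ aszA K t γ)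
    (hKPb : ∀ K t, |t| ≤ l₀ → ∀ γ ∈ Λ K \ O K t, ∑ γ' ∈ (Λ K \ O K t) with inc γ' γ,
      b K t γ' * Real.exp (r K * |Real.log (b K t γ') - Real.log (a K t γ')|) * Real.exp (aszB K t γ') ≤ aszB K t γ)
    (K₀ : ℕ) (hreg : ∀ K, K₀ ≤ K → ∀ t, |t| ≤ l₀ →
      1 - ∑ X ∈ (Λ K \ O K t).powerset with IsCompatible inc X,
        Real.sqrt (((∏ γ ∈ X, a K t γ) / ∑ Y ∈ (Λ K \ O K t).powerset with IsCompatible inc Y, ∏ γ ∈ Y, a K t γ)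
          * ((∏ γ ∈ X, b K t γ) / ∑ Y ∈ (Λ K \ O K t).powerset with IsCompatible inc Y, ∏ γ ∈ Y, b K t γ)) ≤ 1 / 16) :
    ∃ η' : ℕ → ℝ, (∀ K, 0 ≤ η' K) ∧ Summable (fun K => Real.sqrt (η' K)) ∧
      ∀ K t, |t| ≤ l₀ →
        1 - ∑ X ∈ (Λ K).powerset with IsCompatible inc X,
          Real.sqrt (((∏ γ ∈ X, a K t γ) / ∑ Y ∈ (Λ K).powerset with IsCompatible inc Y, ∏ γ ∈ Y, a K t γ)
            * ((∏ γ ∈ X, b K t γ) / ∑ Y ∈ (Λ K).powerset with IsCompatible inc Y, ∏ γ ∈ Y, b K t γ)) ≤ η' K := by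
  have hXΛ : ∀ K, ∀ X ∈ (Λ K).powerset.filter (fun X => IsCompatible inc X), X ⊆ Λ K :=
    fun K X hX => Finset.mem_powerset.1 (Finset.mem_filter.1 hX).1
  have hA : ∀ K t, |t| ≤ l₀ → ∀ X ∈ (Λ K).powerset.filter (fun X => IsCompatible inc X), 0 ≤ ∏ γ ∈ X, a K t γ :=
    fun K t ht X hX => Finset.prod_nonneg fun γ hγ => (ha K t ht γ (hXΛ K X hX hγ)).le
  have hB : ∀ K t, |t| ≤ l₀ → ∀ X ∈ (Λ K).powerset.filter (fun X => IsCompatible inc X), 0 ≤ ∏ γ ∈ X, b K t γ :=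
    fun K t ht X hX => Finset.prod_nonneg fun γ hγ => (hb K t ht γ (hXΛ K X hX hγ)).le
  obtain ⟨wm, hwm, hwA, hwB, hws⟩ := wildMassLetter_of_records_log
    (T := fun K => (Λ K).powerset.filter (fun X => IsCompatible inc X))
    (A := fun K t X => ∏ γ ∈ X, a K t γ) (B := fun K t X => ∏ γ ∈ X, b K t γ)
    (Bad := fun K t => ((Λ K).powerset.filter (fun X => IsCompatible inc X)).filter (fun X => ¬ Disjoint X (O K t)))
    Cell hV hΛ₀ hcell Wd step E Bi hE hκ ρ hρ hρbar hρbar0 η hη hηbar hr0 hr1 hC hA hB hdomA hdomB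
  exact affinityDefectLetter_of_kpMargins inc Λ O a b aszA aszB ha hb wm hwm hwA hwB hws r hr hrs h𝔄 h𝔄A h𝔄B hKPa hKPb K₀ hreg

end RecordPrices

/-! ## §3 Bookkeeping: the `SlotDom` hypothesis on an empty wild class [folklore] -/

section Bookkeeping

/-- A6 bookkeeping [folklore]: when the bad class is EMPTY at every admissible `(K,t)`, `SlotDom l₀ T A Bad S` holds for ANY non-negative budget `S` — take NO
slots (the switch-off structure with all flags clear).  With p620730's `toy_noPolymers` (empty gas: no KP margin to check, tame regime `0 ≤ 1∕16`) this shows the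
antecedent of §1 is jointly satisfiable — source-free non-vacuity; it also records once more that the weight face ALONE is junk-inhabited (content only jointly
with the core-edge face, START-LIST §n20 FACTS). -/
theorem slotDom_of_bad_eq_empty {ι : Type*} [DecidableEq ι] {l₀ : ℝ} {T : ℕ → Finset ι} {A : ℕ → ℝ → ι → ℝ}
    {Bad : ℕ → ℝ → Finset ι} {S : ℕ → ℝ} (hBad : ∀ K t, |t| ≤ l₀ → Bad K t = ∅) (hS : ∀ K, 0 ≤ S K) :
    SlotDom l₀ T A Bad S where
  dom K t ht := by
    refine ⟨0, ⟨fun _ _ => false, fun _ τ => τ, fun _ _ h => h, fun _ _ => rfl, fun _ _ _ _ => rfl, fun _ _ _ => rfl⟩,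
      Fin.elim0, fun i => i.elim0, by simpa using hS K, ?_, fun i => i.elim0⟩
    rw [hBad K t ht]
    ext τ
    simp [SwitchOff.mem_bad, SwitchOff.charge]

end Bookkeeping

end Summit.QuantumFields.YangMills.BalabanUVNodes.N20HellingerLetterOfSlotPricesAndKPMargins

end
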